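import Summits.RiemannHypothesis.RiemannHypothesis.Theorems.Splittings.LiOneStepRephasing
import HarnessLib

/-!
# LI B18 KERNEL Q3/6 — SCHEDULES OF SCALES AND THE CHAINED RE-PHASING `glim` (SketchG16B §7 + the §9 `Schedule` monotonicity trio) — RH-FREE

PRE-CUT (not filed).  Lane (xi-q) «LI B18 KERNEL» ×6 = Q1 `LiRephasingGainBudget` → Q2 `LiOneStepRephasing` → Q3 `LiRephasingSchedule` →
Q4 `LiRephasingScales` → Q5 `LiRephasingMovingCutPrelim` → Q6 `LiRephasingMovingCut` RESERVED by RULING #204 (rh-split lead g6,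
2026-08-27T18:03:10Z): GO = (xi-p) `LiRephasingKit` ACCEPTED (p553624, 18:01:43Z) + referee g8 BYTES and negctl replay on the six carved shas;
LOWEST priority; filing words `--supports stmt-RiemannHypothesis-19649 --as helper`, kind auto, parts land in chain order.  Cell rh-split,
seat rh-split-li-bridge (kernel author g16, cutter g17; brief sha16 f79c5f09d8bcb036), card `run/shared/lean/pub/rh-split/cards/SPLIT-li-bridge.md`
§23 / 23.8 (model barrier B18 «INCREMENT-LEVEL RE-PHASING ⟂ COUNTING-LAW BRIDGES»).  Kernel source `HOME/rh-split-li-bridge/SketchG16B.lean`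
sha16 cf2b65fdbda323e2 (1639 l, ns `RhSplit.LiBridgeG16`, farm rc 0 · 0 err · 0 warn · 0 sorry, std axioms; §§1–6 = `SketchG16.lean`
355f955084e6fc2c byte-identical prefix, referee REPLAY PASS 17:02Z / RULING #176; §§7–9 referee REPLAY PASS 17:28:47Z / RULING #186);
cut plan `CARVE-16.md` 677f9696f1bd3382; reconstruction note `HOME/rh-split-li-bridge/carve-16/README.md` (CUT ONLY — no regeneration).
THIS PART = scratch ll.671–879 (§7: `structure Schedule`, `namespace Schedule … end Schedule`) and ll.1403–1426 (the §9 sub-block «The schedule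
with moving cuts»: `Schedule.T_mono`, `Schedule.Y_mono`, `Schedule.not_mem_zone_of_gap`, placed HERE — directly after §7's `end Schedule` —
so that the three dot-notation lemmas live in the namespace of the structure, `…LiRephasingSchedule.Schedule`, exactly as every other
`Schedule` lemma; they use §7 only; this PLACEMENT is the one deviation from the CARVE-16 table, which listed them under Q5)
↦ ll.54–262 / 264–287 here; decl text BYTE-VERBATIM (statements AND proofs, scratch section headers kept).  Deltas = namespace
`RhSplit.LiBridgeG16` ↦ `Summit.RiemannHypothesis.RiemannHypothesis.Theorems.Splittings.LiRephasingSchedule`, imports (Q2 `…Splittings.LiOneStepRephasing` + HarnessLib),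
this header, `set_option linter.dupNamespace false`, the `open` lines (the scratch's + `…Splittings.LiRephasingKit` + the earlier parts'
namespaces).  The six SketchG15B lemmas of scratch §1 (`exists_sin_eq_neg_one_of_phase_drop`, `four_sin_half_mul_sin`,
`sum_range_phase_telescope`, `abs_sum_range_phase_le`, `abs_sum_range_family_le`, `exists_le_on_block`) are CITED from the tree's
`LiRephasingKit` (lane (xi-p)), never restated.

Content: §7 `structure Schedule` (data `k ↦ (N_k, T_k, J_k, m_k, Y_k, A_k)` + the per-scale hypotheses of `floor_violation` +
separation `Y_k ≤ T_{k+1}`), zones, `Schedule.step` (= `floor_violation` at scale `k`), the chained assignments `gseq`, the limit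
assignment **`Schedule.glim`** (each zero moved at most once, only inside its zone, only if selected, downward), `chain_violates`
(the floor `−A_k` is violated at some `n ∈ [N_k, 2N_k)` of EVERY scale), `glim_eq_im`, `glim_sparse`, `glim_moved(_spacing)`, `glim_count`;
plus `T_mono` / `Y_mono` / `not_mem_zone_of_gap`.  1 structure, 3 defs, 24 theorems.

HONEST LABEL: SPLITTING SEARCH over kernel-typed RH-EQUIVALENCES; a splitting A ∧ B ⟹ RH is CONDITIONAL bookkeeping
unless A and B are both proved; nothing here bears on the truth of RH.  Every theorem below is PURE (trigonometry /
finite sums / calculus / parameter arithmetic) or RH-FREE (about the true zeta zeros, no hypothesis on their real parts);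
none is a claim about RH, PL or K7ev; the whole chain is BARRIER-SIDE bookkeeping (B18), not a conjunct toward RH.
-/

set_option linter.dupNamespace false

namespace Summit.RiemannHypothesis.RiemannHypothesis.Theorems.Splittings.LiRephasingSchedule

open Real Set Finset
open Literature.NumberTheory.LFunctions Literature.NumberTheory.LFunctions.SchoenfeldBound
open Literature.NumberTheory.LFunctions.AlpogeFurman2026
open Literature.NumberTheory.LFunctions.SoundTest
open Summit.RiemannHypothesis.RiemannHypothesis.Theorems.LiTheory
open Summit.RiemannHypothesis.RiemannHypothesis.Theorems.Splittings
open Summit.RiemannHypothesis.RiemannHypothesis.Theorems.Splittings.LiIncrHighPart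
open Summit.RiemannHypothesis.RiemannHypothesis.Theorems.Splittings.LiRephasingKit
open Summit.RiemannHypothesis.RiemannHypothesis.Theorems.Splittings.LiRephasingGainBudget
open Summit.RiemannHypothesis.RiemannHypothesis.Theorems.Splittings.LiOneStepRephasing

/-! ## §7 Chaining over scales (THEOREM A∞, structural part) — RH-FREE

`one_step` accepts ANY base assignment `g₀`, so the one-step re-phasings CHAIN along a SCHEDULE of scales whose zones
lie above all earlier cuts.  A `Schedule` bundles the parameter sequences `k ↦ (N_k, T_k, J_k, m_k, Y_k, A_k)` with the
finitely many inequalities `floor_violation` needs at each scale plus the separation `Y_k ≤ T_{k+1}`; the EXISTENCE of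
a schedule (e.g. `N_k = N_{k-1}^4`, zone `(Y_{2N_{k-1}}, √(N_k/(16 log N_k))]`, `m_k = ⌊log N_k/50⌋`,
`A_k = ½ log 2N_k − K + 1 + drift`) is elementary asymptotic arithmetic and stays on paper (card §23.3).  Given a
schedule, ONE assignment `glim` (each zero moved at most once, only inside its zone, only if selected, downward by
`≤ 4πγ²/(N_k+½)`) violates the floor `−A_k` at some index of every block `[N_k, 2N_k)`. -/

/-- A SCHEDULE of scales for the chained re-phasing (data + the per-scale hypotheses of `floor_violation` + separation). -/
structure Schedule where
  /-- block `[N_k, 2N_k)` -/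
  N : ℕ → ℕ
  /-- zone bottom `T_k ≥ 260` -/
  T : ℕ → ℝ
  /-- zone `(T_k, 2^{J_k} T_k]` -/
  J : ℕ → ℕ
  /-- sparsity: every `m_k`-th zero of the zone is moved -/
  m : ℕ → ℕ
  /-- cut `Y_k` -/
  Y : ℕ → ℝ
  /-- floor `−A_k` to be violated -/
  A : ℕ → ℝ
  hT : ∀ k, 260 ≤ T k
  hY : ∀ k, 2 ^ (J k) * T k ≤ Y k
  hsep : ∀ k, Y k ≤ T (k + 1)
  hm : ∀ k, 0 < m k
  hN : ∀ k, 0 < N k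
  hreach : ∀ k, 16 * π * (2 ^ (J k) * T k) ≤ (N k : ℝ)
  hbudget : ∀ k, 13 * (m k) * (A k + 4 * (∑ ρ ∈ zerosBetween 0 (Y k), mult ρ) / (N k)) ≤
    (J k) * Real.log (T k / (2 * π)) + Real.log 2 * ((J k) * ((J k) - 1) / 2)

namespace Schedule

variable (S : Schedule)

/-- The `k`-th zone `(T_k, 2^{J_k} T_k]`. -/
noncomputable def zone (k : ℕ) : Finset ℂ := zerosBetween (S.T k) (2 ^ (S.J k) * S.T k)

/-- The schedule's heights are positive: `0 < T k`. PURE. -/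
theorem T_pos (k : ℕ) : 0 < S.T k := by linarith [S.hT k]

/-- `T k ≤ 2^{J k} · T k` (the zone `k` is a genuine window). PURE. -/
theorem T_le_top (k : ℕ) : S.T k ≤ 2 ^ (S.J k) * S.T k :=
  le_mul_of_one_le_left (S.T_pos k).le (one_le_pow₀ (by norm_num))

/-- Membership in zone `k` unfolds to `T k < Im ρ ≤ 2^{J k} · T k`. PURE. -/
theorem mem_zone {k : ℕ} {ρ : ℂ} (h : ρ ∈ S.zone k) : S.T k < ρ.im ∧ ρ.im ≤ 2 ^ (S.J k) * S.T k := by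
  have h' := (mem_zerosBetween (S.T_pos k).le).1 h
  exact ⟨h'.2.2.2.1, h'.2.2.2.2⟩

/-- Cuts lie below all later zones: `Y_j ≤ T_k` for `j < k`. -/
theorem Y_le_T {j k : ℕ} (hjk : j < k) : S.Y j ≤ S.T k := by
  induction k with
  | zero => exact absurd hjk (Nat.not_lt_zero _)
  | succ k ih =>
    rcases Nat.lt_succ_iff_lt_or_eq.1 hjk with h | h
    · exact (ih h).trans ((S.T_le_top k).trans ((S.hY k).trans (S.hsep k)))
    · subst h; exact S.hsep j

/-- The zones are pairwise disjoint. -/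
theorem zone_disjoint {j k : ℕ} {ρ : ℂ} (hj : ρ ∈ S.zone j) (hk : ρ ∈ S.zone k) : j = k := by
  by_contra hne
  rcases Nat.lt_or_gt_of_ne hne with h | h
  · have := S.Y_le_T h
    linarith [(S.mem_zone hj).2, (S.mem_zone hk).1, S.hY j]
  · have := S.Y_le_T h
    linarith [(S.mem_zone hk).2, (S.mem_zone hj).1, S.hY k]

/-- One step of the chain at scale `k` from the base assignment `g₀` (= `floor_violation`, existentials reordered). -/
theorem step (g₀ : ℂ → ℝ) (k : ℕ) : ∃ g : ℂ → ℝ, ∃ n ∈ Finset.Ico (S.N k) (2 * S.N k), ∃ c < S.m k,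
    (∀ ρ, ρ ∉ sel (S.zone k) (S.m k) c → g ρ = g₀ ρ) ∧
    (∀ ρ ∈ sel (S.zone k) (S.m k) c, ρ.im - 4 * π * ρ.im ^ 2 / ((n : ℝ) + 1 / 2) ≤ g ρ ∧ g ρ ≤ ρ.im) ∧
    lowSumRe g n (S.Y k) ≤ -S.A k := by
  obtain ⟨n, hn, c, hc, g, h1, h2, h3⟩ :=
    floor_violation g₀ (S.hT k) (S.J k) (S.hY k) (S.hm k) (S.hN k) (S.hreach k) (S.hbudget k)
  exact ⟨g, n, hn, c, hc, h1, h2, h3⟩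

/-- The chained assignments: `gseq 0 = γ`, `gseq (k+1)` = the step at scale `k` from `gseq k`. -/
noncomputable def gseq : ℕ → (ℂ → ℝ)
  | 0 => fun ρ ↦ ρ.im
  | k + 1 => (S.step (gseq k) k).choose

/-- The rephasing sequence starts at the true ordinates: `gseq 0 = Im`. PURE (by `rfl`). -/
theorem gseq_zero : S.gseq 0 = fun ρ ↦ ρ.im := rfl

/-- Step `k+1` of the rephasing sequence is the chosen one-step move on zone `k`. PURE (by `rfl`). -/
theorem gseq_succ (k : ℕ) : S.gseq (k + 1) = (S.step (S.gseq k) k).choose := rfl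

/-- The specification of step `k+1`: some admissible `n ∈ [N k, 2 N k)` and rank class `c < m k` are moved, every other zero is untouched. PURE. -/
theorem gseq_succ_spec (k : ℕ) : ∃ n ∈ Finset.Ico (S.N k) (2 * S.N k), ∃ c < S.m k,
    (∀ ρ, ρ ∉ sel (S.zone k) (S.m k) c → S.gseq (k + 1) ρ = S.gseq k ρ) ∧
    (∀ ρ ∈ sel (S.zone k) (S.m k) c,
      ρ.im - 4 * π * ρ.im ^ 2 / ((n : ℝ) + 1 / 2) ≤ S.gseq (k + 1) ρ ∧ S.gseq (k + 1) ρ ≤ ρ.im) ∧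
    lowSumRe (S.gseq (k + 1)) n (S.Y k) ≤ -S.A k := by
  rw [gseq_succ]
  exact (S.step (S.gseq k) k).choose_spec

/-- Off its zone, step `k` changes nothing. -/
theorem gseq_succ_of_not_mem {k : ℕ} {ρ : ℂ} (h : ρ ∉ S.zone k) : S.gseq (k + 1) ρ = S.gseq k ρ := by
  obtain ⟨n, -, c, -, h1, -, -⟩ := S.gseq_succ_spec k
  exact h1 ρ fun h' ↦ h (sel_subset _ _ _ h')

/-- A zero of zone `j` is never touched again after step `j`. -/
theorem gseq_stable {j : ℕ} {ρ : ℂ} (hρ : ρ ∈ S.zone j) (d : ℕ) : S.gseq (j + 1 + d) ρ = S.gseq (j + 1) ρ := by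
  induction d with
  | zero => rfl
  | succ d ih =>
    rw [show j + 1 + (d + 1) = (j + 1 + d) + 1 by ring, S.gseq_succ_of_not_mem, ih]
    intro h
    have := S.zone_disjoint hρ h
    omega

/-- A zero lying in none of the first `k` zones still has its true ordinate after `k` steps. -/
theorem gseq_eq_im {k : ℕ} {ρ : ℂ} (h : ∀ j < k, ρ ∉ S.zone j) : S.gseq k ρ = ρ.im := by
  induction k with
  | zero => rfl
  | succ k ih =>
    rw [S.gseq_succ_of_not_mem (h k (Nat.lt_succ_self k))]
    exact ih fun j hj ↦ h j (hj.trans (Nat.lt_succ_self k))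

open Classical in
/-- THE LIMITING ASSIGNMENT: a zero of zone `j` gets its step-`j` ordinate, every other zero keeps `γ`. -/
noncomputable def glim (ρ : ℂ) : ℝ :=
  if h : ∃ j, ρ ∈ S.zone j then S.gseq (h.choose + 1) ρ else ρ.im

/-- On zone `k` the limit rephasing equals step `k+1`. PURE. -/
theorem glim_of_mem {k : ℕ} {ρ : ℂ} (hρ : ρ ∈ S.zone k) : S.glim ρ = S.gseq (k + 1) ρ := by
  have h : ∃ j, ρ ∈ S.zone j := ⟨k, hρ⟩
  rw [glim, dif_pos h, S.zone_disjoint h.choose_spec hρ]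

/-- Off every zone the limit rephasing is the identity `Im`. PURE. -/
theorem glim_of_not_mem {ρ : ℂ} (h : ∀ j, ρ ∉ S.zone j) : S.glim ρ = ρ.im := by
  rw [glim, dif_neg (not_exists.2 h)]

/-- Below the cut `Y_k`, the limiting assignment agrees with the assignment after step `k`. -/
theorem glim_eq_gseq_succ {k : ℕ} {ρ : ℂ} (hρ : ρ ∈ zerosBetween 0 (S.Y k)) : S.glim ρ = S.gseq (k + 1) ρ := by
  have hY : ρ.im ≤ S.Y k := ((mem_zerosBetween le_rfl).1 hρ).2.2.2.2
  by_cases h : ∃ j, ρ ∈ S.zone j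
  · obtain ⟨j, hj⟩ := h
    have hjk : j ≤ k := by
      by_contra hlt
      have := S.Y_le_T (Nat.lt_of_not_le hlt)
      linarith [(S.mem_zone hj).1]
    obtain ⟨d, hd⟩ := Nat.exists_eq_add_of_le hjk
    rw [S.glim_of_mem hj, hd, show j + d + 1 = j + 1 + d by ring, S.gseq_stable hj d]
  · rw [S.glim_of_not_mem (not_exists.1 h), S.gseq_eq_im fun j _ ↦ not_exists.1 h j]

/-- **CHAINING THEOREM (THEOREM A∞, structural part; RH-FREE).**  Along any schedule, the single limiting assignment
`glim` violates the floor `−A_k` at some index of EVERY block `[N_k, 2N_k)`. -/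
theorem chain_violates (k : ℕ) : ∃ n ∈ Finset.Ico (S.N k) (2 * S.N k), lowSumRe S.glim n (S.Y k) ≤ -S.A k := by
  obtain ⟨n, hn, c, -, -, -, h3⟩ := S.gseq_succ_spec k
  refine ⟨n, hn, ?_⟩
  have e : lowSumRe S.glim n (S.Y k) = lowSumRe (S.gseq (k + 1)) n (S.Y k) := by
    unfold lowSumRe
    exact Finset.sum_congr rfl fun ρ hρ ↦ by rw [S.glim_eq_gseq_succ hρ]
  rw [e]; exact h3

/-- `glim` moves nothing outside the zones … -/
theorem glim_eq_im {ρ : ℂ} (h : ∀ j, ρ ∉ S.zone j) : S.glim ρ = ρ.im := S.glim_of_not_mem h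

/-- … inside zone `k` it moves only the selected class (every `m_k`-th zero) … -/
theorem glim_sparse (k : ℕ) : ∃ c < S.m k, ∀ ρ ∈ S.zone k, ρ ∉ sel (S.zone k) (S.m k) c → S.glim ρ = ρ.im := by
  obtain ⟨n, -, c, hc, h1, -, -⟩ := S.gseq_succ_spec k
  refine ⟨c, hc, fun ρ hρ hsel ↦ ?_⟩
  rw [S.glim_of_mem hρ, h1 ρ hsel]
  exact S.gseq_eq_im fun j hj h' ↦ absurd (S.zone_disjoint hρ h') (Nat.ne_of_gt hj)

/-- … and every zero of zone `k` DOWNWARD by at most `4πγ²/(N_k + ½)`. -/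
theorem glim_moved {k : ℕ} {ρ : ℂ} (hρ : ρ ∈ S.zone k) :
    ρ.im - 4 * π * ρ.im ^ 2 / ((S.N k : ℝ) + 1 / 2) ≤ S.glim ρ ∧ S.glim ρ ≤ ρ.im := by
  obtain ⟨n, hn, c, -, h1, h2, -⟩ := S.gseq_succ_spec k
  rw [S.glim_of_mem hρ]
  have hpos : 0 ≤ 4 * π * ρ.im ^ 2 / ((S.N k : ℝ) + 1 / 2) := by positivity
  by_cases hsel : ρ ∈ sel (S.zone k) (S.m k) c
  · obtain ⟨hlo, hhi⟩ := h2 ρ hsel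
    have hNn : (S.N k : ℝ) ≤ n := by exact_mod_cast (Finset.mem_Ico.1 hn).1
    have : 4 * π * ρ.im ^ 2 / ((n : ℝ) + 1 / 2) ≤ 4 * π * ρ.im ^ 2 / ((S.N k : ℝ) + 1 / 2) :=
      div_le_div_of_nonneg_left (by positivity) (by positivity) (by linarith)
    exact ⟨by linarith, hhi⟩
  · rw [h1 ρ hsel, S.gseq_eq_im fun j hj h' ↦ absurd (S.zone_disjoint hρ h') (Nat.ne_of_gt hj)]
    exact ⟨by linarith, le_rfl⟩

/-- With the decorrelation condition `32·(2^{J_k}T_k)²·log(2^{J_k}T_k) ≤ N_k` in the schedule, every move is at most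
ONE SIXTEENTH of the local mean spacing `2π/log γ` and at most `1` (`disp_le_spacing_div`, `disp_le_one`). -/
theorem glim_moved_spacing (hdec : ∀ k, 32 * (2 ^ (S.J k) * S.T k) ^ 2 * Real.log (2 ^ (S.J k) * S.T k) ≤ (S.N k : ℝ))
    {k : ℕ} {ρ : ℂ} (hρ : ρ ∈ S.zone k) :
    ρ.im - 2 * π / Real.log ρ.im / 16 ≤ S.glim ρ ∧ ρ.im - 1 ≤ S.glim ρ ∧ S.glim ρ ≤ ρ.im := by
  obtain ⟨hlo, hhi⟩ := S.glim_moved hρ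
  obtain ⟨h1, h2⟩ := S.mem_zone hρ
  have hx : 260 < ρ.im := lt_of_le_of_lt (S.hT k) h1
  have hlogx : 0 ≤ Real.log ρ.im := Real.log_nonneg (by linarith)
  have hmono : 32 * ρ.im ^ 2 * Real.log ρ.im ≤ 32 * (2 ^ (S.J k) * S.T k) ^ 2 * Real.log (2 ^ (S.J k) * S.T k) := by
    have hlog : Real.log ρ.im ≤ Real.log (2 ^ (S.J k) * S.T k) := Real.log_le_log (by linarith) h2
    have hsq : ρ.im ^ 2 ≤ (2 ^ (S.J k) * S.T k) ^ 2 := pow_le_pow_left₀ (by linarith) h2 2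
    have hlog' : 0 ≤ Real.log (2 ^ (S.J k) * S.T k) := hlogx.trans hlog
    nlinarith
  have h : 32 * ρ.im ^ 2 * Real.log ρ.im ≤ (S.N k : ℝ) + 1 / 2 := by linarith [hdec k]
  have d1 := disp_le_spacing_div (by linarith) h
  have d2 := disp_le_one (by linarith) h
  exact ⟨by linarith, by linarith, hhi⟩

/-- Hence the counting function of `glim` stays within one unit window of the truth (`countRe_squeeze`). RH-FREE. -/
theorem glim_count (hdec : ∀ k, 32 * (2 ^ (S.J k) * S.T k) ^ 2 * Real.log (2 ^ (S.J k) * S.T k) ≤ (S.N k : ℝ))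
    (Y : ℝ) {t : ℝ} (ht : 0 ≤ t) :
    countRe (fun ρ ↦ ρ.im) Y t ≤ countRe S.glim Y t ∧
      countRe S.glim Y t ≤ countRe (fun ρ ↦ ρ.im) Y t + 3 * Real.log (t + 2) := by
  refine countRe_squeeze (fun ρ _ ↦ ?_) ht
  by_cases h : ∃ j, ρ ∈ S.zone j
  · obtain ⟨j, hj⟩ := h
    obtain ⟨-, h2, h3⟩ := S.glim_moved_spacing hdec hj
    exact ⟨h2, h3⟩
  · rw [S.glim_of_not_mem (not_exists.1 h)]
    exact ⟨by linarith, le_rfl⟩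

end Schedule

/-! ### The schedule with moving cuts -/

namespace Schedule

variable (S : Schedule)

/-- The heights `T k` of a schedule with moving cuts are monotone. PURE. -/
theorem T_mono : Monotone S.T :=
  monotone_nat_of_le_succ fun k ↦ ((S.T_le_top k).trans (S.hY k)).trans (S.hsep k)

/-- The cuts `Y k` of a schedule with moving cuts are monotone. PURE. -/
theorem Y_mono : Monotone S.Y :=
  monotone_nat_of_le_succ fun k ↦ ((S.hsep k).trans (S.T_le_top (k + 1))).trans (S.hY (k + 1))

/-- A zero strictly above the cut `Y_k` and not above the next floor `T_{k+1}` lies in NO zone. -/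
theorem not_mem_zone_of_gap {k : ℕ} {ρ : ℂ} (h1 : S.Y k < ρ.im) (h2 : ρ.im ≤ S.T (k + 1)) (j : ℕ) :
    ρ ∉ S.zone j := by
  intro hρ
  have hm := S.mem_zone hρ
  rcases le_or_gt j k with hjk | hjk
  · have : (2 : ℝ) ^ S.J j * S.T j ≤ S.Y k := (S.hY j).trans (S.Y_mono hjk)
    linarith [hm.1, hm.2]
  · have : S.T (k + 1) ≤ S.T j := S.T_mono (by omega)
    linarith [hm.1, hm.2]

end Schedule

end Summit.RiemannHypothesis.RiemannHypothesis.Theorems.Splittings.LiRephasingSchedule
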